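import Summits.ResolutionOfSingularities.ResolutionOfSingularities.Theorems.MarkedTransferCampaignW12SandwichBoxCriterion
import Literature.AlgebraicGeometry.Hironaka2017.NegaWitness
import Mathlib.RingTheory.MvPolynomial.Ideal
import HarnessLib

/-!
# [OURS · L1 W1.2] Rung 1 of variant V1: the ORDER-ZERO OBSTRUCTION to the shape of Eq. (59) — on W1's first
# transform the sandwich (and every other Def-5.1-shaped) negative module is NOT of the form `x^a · (…)`, for every
# `a ≥ 1`, every level `e`, every base ring of operators (seat res-L1-s12-pv-1)

LADDER-RESOLUTION rung L (rescue), cell `res-hironaka`, RESCUE-SEED §1 slot **W1.2**, variant **V1** (sandwich +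
box-flat heads; director 21:05:07Z «KEEP RUNNING ON V1 ONLY»; res-plan-2 21:27:13Z, accepted 21:27:42Z: «s12's rung 1
must be (59)/(108) on W1's FIRST TRANSFORM under V1 (one Lean computation) … if the first transform leaves V1 or (59)
fails there, V1 is content-free for R08»). THIS FILE IS THAT COMPUTATION for Eq. (59), at ring level, and its answer
is NEGATIVE AND READING-INDEPENDENT:

* V1 PERSISTS at the first-transform point: `W1'_tail_mem_box` — the tail `ε′ = x·w₁²` of `g′ = y₁² + x·w₁²`
  (tree `Nega.g3'`, `Nega.xChart_g3 : g(x, x y₁, x w₁) = x²·g′`) lies in `𝔪_{ξ′}^{[2]} = (x², y₁², w₁²)`.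
* Eq. (59) FAILS there, for the sandwich modules of EVERY level `e` and in EVERY degree `−a`, `a ≥ 1`
  (`W1'_sandwichPNega_ne_exc_mul`): there is NO ideal `N ⊆ O_{ξ′}` with `℘nega_sw(E′,−a) = (x^a)·N` — whereas the
  right-hand side of (59), «`(∏ I(D_i,Z_i)^a)·(℘nega(E,−a)O_{Z′})`» (typed `S07Permissible.Eq59` / `Eq59At`, row 013;
  one point blow-up: `I(D)O_{Z′} = (x)` in the x-chart), IS of that form.
* The MECHANISM is the order-zero summand of Def 5.1 and nothing else (`le_pTildeNeg_of_dvd`, `le_sandwichPNega`):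
  `℘̃(E′,−a) = Σ_{dm ≥ a} Diff^{(dm+a)} ℘posi(E′,dm) ⊇ ℘posi(E′,dm) ∋ g′^d` (the identity is an operator of order `0`
  in EVERY operator class — absolute `Diff_{Z′}` over any base `K`, Grothendieck-relative to `ρ^e`, graded, V1 …),
  and `g′^d ∉ (x)` (`g3'_pow_not_mem_span_X0`). So the failure is NOT caused by a manufactured unit (W1 is unit-free
  under the sandwich in every degree, res-L1-k12 p467948 `W1_sandwichNegaNoUnit`) and NO choice of differential
  operators can repair the EQUALITY (59) as printed; only its `⊇` half is operator-sensitive. Stated once over row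
  008's carrier with an ARBITRARY base ring of operators (`pNega_ne_mul_of_not_mem`), so it applies verbatim to the
  printed absolute modules (R04's own object) and to the sandwich ones (`sandwichPNega = pNega (ρ^e O)` by `rfl`).

What this file does NOT do: it does not touch Th 14.2 (108) (the other consumer named for V1; LL-chain machinery
`𝔏_0(∞)`, `θ_e` — not a one-file computation), it does not compute `℘(E′,·)` (only `g′^d ∈ ℘(E′,2d)`, hypothesis
(П1′) = Th 4.1 (1) shape «`J′ ⊂ ℘(E′,b)`», is used), and it takes no view on GAP row R04 (lead res-adj-1; R04 not
yet OPEN at the time of writing — its E1 census note 20:32:44Z anticipates «LHS = O_{ξ′}, RHS ⊂ I(D)^a O_{ξ′}» under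
the R01 collapse; the present obstruction needs no collapse).

HONEST FRAMING. OURS statements about OUR objects and about the typed carrier of Def 5.1 (row 008
`S05NegativePart.pNega`, any base ring); Def 5.1 / Eq. (36) (p.25 L31–L44), Rem 7.7 and Th 7.8 / Eq. (59) (p.36 L49 –
p.37 L20) are CANDIDATES [claim: Hironaka2017, status: under-review] entering only through typed carriers and the
hypothesis `g′^d ∈ P′(2d)`; nothing here is a statement of the manuscript, a verdict on R04, or progress on resolution
of singularities in positive characteristic. BARRIER LINE as in p467195 (`FrobeniusTwistResolution.*`: ideal-membership
facts only, nothing transports across `ρ^e(O) ⊂ O`). AI proof is weaker than expert review.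
-/

noncomputable section

set_option linter.dupNamespace false -- mandated namespace of this single-conjunct summit

namespace Summit.ResolutionOfSingularities.ResolutionOfSingularities.Theorems.Campaign.W12

open MvPolynomial
open Literature.AlgebraicGeometry.Resolution
open Literature.AlgebraicGeometry.Hironaka2017
open Summit.ResolutionOfSingularities.ResolutionOfSingularities.Theorems.Campaign

universe u v

/-! ## §1 The order-zero summand of Def 5.1, over ANY base ring of operators -/

section AnyBase

variable (K : Type u) {A : Type v} [CommRing K] [CommRing A] [Algebra K A]

/-- **Order-zero summand.** For every base ring `K` of operators (absolute `Diff_{A/K}`, or the sandwich `K = ρ^e(A)`):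
`℘posi(E,dm) ⊆ D(m,a,d) = Diff^{(dm+a)}_{A/K} ℘posi(E,dm)` — the identity has order `0` (tree `le_diffIdeal`).
[folklore] -/
theorem pPosi_le_DD (P : ℕ → Ideal A) (m : ℕ) (a d : ℤ) :
    S05NegativePart.pPosi P (d * m).toNat ≤ S05NegativePart.DD K P m a d :=
  le_diffIdeal K _ _

/-- Hence `℘(E,dm) ⊆ ℘̃(E,−a)` for every `d ≥ 1` with `a ≤ dm ≠ 0`, `a : ℕ` — row 008's `pNega K P m a`, ANY base
`K`. [folklore] -/
theorem le_pNega_of_le (P : ℕ → Ideal A) {m a d : ℕ} (had : a ≤ d * m) (hdm : d * m ≠ 0) :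
    P (d * m) ≤ S05NegativePart.pNega K P m a := by
  unfold S05NegativePart.pNega S05NegativePart.pTildeNeg
  have hdm' : |(a : ℤ)| ≤ (d : ℤ) * m := by rw [Nat.abs_cast]; exact_mod_cast had
  refine le_trans ?_ (le_iSup₂ (f := fun (d : ℤ) (_ : |(a : ℤ)| ≤ d * m) => S05NegativePart.DD K P m a d)
    (d : ℤ) hdm')
  refine le_trans ?_ (pPosi_le_DD K P m a d)
  have h1 : ((d : ℤ) * m).toNat = d * m := by
    rw [show ((d : ℤ) * m) = ((d * m : ℕ) : ℤ) by push_cast; ring, Int.toNat_natCast]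
  rw [h1, S05NegativePart.pPosi, if_neg hdm]

/-- **The order-zero obstruction to the SHAPE of Eq. (59).** If some `f ∈ ℘(E,dm)` (`a ≤ dm ≠ 0`) is not in the
ideal `I` (e.g. `I = (x^a)`, the exceptional factor of (59)), then `℘nega(E,−a) ≠ I·N` for EVERY ideal `N` — for
row 008's carrier over ANY base ring of operators `K`. [folklore] -/
theorem pNega_ne_mul_of_not_mem (P : ℕ → Ideal A) {m a d : ℕ} (had : a ≤ d * m) (hdm : d * m ≠ 0) {f : A}
    (hf : f ∈ P (d * m)) (I : Ideal A) (hfI : f ∉ I) (N : Ideal A) : S05NegativePart.pNega K P m a ≠ I * N :=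
  fun h => hfI (Ideal.mul_le_right (h ▸ le_pNega_of_le K P had hdm hf))

end AnyBase

/-! ## §2 The sandwich modules (typed `Campaign.sandwichPNega` = row 008 at base `ρ^e(O)`) -/

section Sandwich

variable {O : Type v} [CommRing O] (p : ℕ) [Fact p.Prime] [CharP O p]

/-- `℘(E,dm) ⊆ ℘nega_sw(E,−a)` (`a ≤ dm ≠ 0`), every level `e`. [folklore] -/
theorem le_sandwichPNega (e : ℕ) (P : ℕ → Ideal O) {m a d : ℕ} (had : a ≤ d * m) (hdm : d * m ≠ 0) :
    P (d * m) ≤ sandwichPNega p e P m a :=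
  le_pNega_of_le _ P had hdm

/-- **Order-zero obstruction, sandwich form**: `f ∈ ℘(E,dm)`, `f ∉ I` ⇒ `℘nega_sw(E,−a) ≠ I·N` for every `N`, every
level `e`. [folklore] -/
theorem sandwichPNega_ne_mul_of_not_mem (e : ℕ) (P : ℕ → Ideal O) {m a d : ℕ} (had : a ≤ d * m)
    (hdm : d * m ≠ 0) {f : O} (hf : f ∈ P (d * m)) (I : Ideal O) (hfI : f ∉ I) (N : Ideal O) :
    sandwichPNega p e P m a ≠ I * N :=
  pNega_ne_mul_of_not_mem _ P had hdm hf I hfI N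

end Sandwich

/-! ## §3 W1's first transform: `g′ = y₁² + x·w₁²` in `𝔽₂[x, y₁, w₁]` (`X 0 = x` exceptional, `X 1 = y₁`, `X 2 = w₁`) -/

section W1prime

/-- Killing the exceptional variable: the `𝔽₂`-algebra map `x ↦ 0`, `y₁ ↦ y₁`, `w₁ ↦ w₁`. (Local notation-free
helper; the images are computed by `simp`.) [folklore] -/
theorem aeval_killX0_X_pow_mul (a : ℕ) (ha : 0 < a) (c : MvPolynomial (Fin 3) (ZMod 2)) :
    aeval ![(0 : MvPolynomial (Fin 3) (ZMod 2)), X 1, X 2] (X 0 ^ a * c) = 0 := by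
  obtain ⟨b, rfl⟩ := Nat.exists_eq_succ_of_ne_zero ha.ne'
  simp [map_mul, map_pow, Matrix.cons_val_zero]

/-- Every element of `(x^a)`, `a ≥ 1`, dies under `x ↦ 0`. [folklore] -/
theorem aeval_killX0_eq_zero_of_mem {a : ℕ} (ha : 0 < a) {h : MvPolynomial (Fin 3) (ZMod 2)}
    (hh : h ∈ Ideal.span {(X 0 : MvPolynomial (Fin 3) (ZMod 2)) ^ a}) :
    aeval ![(0 : MvPolynomial (Fin 3) (ZMod 2)), X 1, X 2] h = 0 := by
  obtain ⟨c, rfl⟩ := Ideal.mem_span_singleton'.mp hh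
  rw [mul_comm]
  exact aeval_killX0_X_pow_mul a ha c

/-- `g′^d ↦ y₁^{2d}` under `x ↦ 0`. [folklore] -/
theorem aeval_killX0_g3'_pow (d : ℕ) :
    aeval ![(0 : MvPolynomial (Fin 3) (ZMod 2)), X 1, X 2] (Nega.g3' ^ d) = X 1 ^ (2 * d) := by
  rw [map_pow, Nega.g3']
  simp [map_add, map_mul, map_pow, Matrix.cons_val_zero, Matrix.cons_val_one, pow_mul]

/-- **`g′^d ∉ (x^a)` for `a ≥ 1`** (`y₁^{2d} ≠ 0` survives `x ↦ 0`). [folklore] -/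
theorem g3'_pow_not_mem_span_X0_pow (d : ℕ) {a : ℕ} (ha : 0 < a) :
    Nega.g3' ^ d ∉ Ideal.span {(X 0 : MvPolynomial (Fin 3) (ZMod 2)) ^ a} := by
  intro h
  have h0 := aeval_killX0_eq_zero_of_mem ha h
  rw [aeval_killX0_g3'_pow] at h0
  exact (pow_ne_zero _ (X_ne_zero (1 : Fin 3))) h0

/-- **V1 PERSISTS at `ξ′`**: the tail `ε′ = x·w₁²` of `g′` lies in the box ideal `𝔪_{ξ′}^{[2]} = 𝔪.map ρ =
(x², y₁², w₁²)`. [folklore] -/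
theorem W1'_tail_mem_box :
    (X 0 * X 2 ^ 2 : MvPolynomial (Fin 3) (ZMod 2)) ∈
      (idealOfVars (Fin 3) (ZMod 2)).map (iterateFrobenius (MvPolynomial (Fin 3) (ZMod 2)) 2 1) := by
  rw [map_iterateFrobenius_idealOfVars]
  exact Ideal.mul_mem_left _ _ (Ideal.subset_span ⟨2, by simp⟩)

/-- `g′ = y₁² + ε′` with head `y₁² = y₁^q`, `q = 2` (the V1 shape «`y^q + ε`, `ε ∈ 𝔪^{[q]}`» at `ξ′`). [folklore] -/
theorem g3'_eq_head_add_tail : Nega.g3' = (X 1 : MvPolynomial (Fin 3) (ZMod 2)) ^ 2 + X 0 * X 2 ^ 2 :=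
  rfl

/-- **RUNG 1 (V1), Eq. (59) on W1's first transform: FAILS in every degree, at every level, by order zero.** For every
family `P′` of ideals of `O′ = 𝔽₂[x,y₁,w₁]` with `g′^d ∈ P′(2d)` for `d ≥ 1` (Th 4.1 (1) shape for `E′ = ((g′), 2)`,
`m = 2`), every level `e` and every `a ≥ 1`: `℘nega_sw(E′,−a) ≠ (x^a)·N` for ALL ideals `N` — so it cannot equal the
right-hand side `(x^a)·(℘nega(E,−a)O′)` of (59), whatever `℘nega(E,−a)` is. Witness summand: `d = a` (`a ≤ 2a`).
[folklore] -/
theorem W1'_sandwichPNega_ne_exc_mul (e : ℕ) (P' : ℕ → Ideal (MvPolynomial (Fin 3) (ZMod 2)))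
    (hg : ∀ d, 0 < d → Nega.g3' ^ d ∈ P' (d * 2)) {a : ℕ} (ha : 0 < a)
    (N : Ideal (MvPolynomial (Fin 3) (ZMod 2))) :
    sandwichPNega 2 e P' 2 a ≠ Ideal.span {(X 0 : MvPolynomial (Fin 3) (ZMod 2)) ^ a} * N :=
  sandwichPNega_ne_mul_of_not_mem 2 e P' (d := a) (by omega) (by omega) (hg a ha) _
    (g3'_pow_not_mem_span_X0_pow a ha) N

/-- The same for row 008's ABSOLUTE carrier over ANY base ring `K` of operators (R04's own object is the case
`K = 𝔽₂`): `℘nega(E′,−a) ≠ (x^a)·N`. Reading-independence of the obstruction. [folklore] -/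
theorem W1'_pNega_ne_exc_mul (K : Type u) [CommRing K] [Algebra K (MvPolynomial (Fin 3) (ZMod 2))]
    (P' : ℕ → Ideal (MvPolynomial (Fin 3) (ZMod 2))) (hg : ∀ d, 0 < d → Nega.g3' ^ d ∈ P' (d * 2)) {a : ℕ}
    (ha : 0 < a) (N : Ideal (MvPolynomial (Fin 3) (ZMod 2))) :
    S05NegativePart.pNega K P' 2 a ≠ Ideal.span {(X 0 : MvPolynomial (Fin 3) (ZMod 2)) ^ a} * N :=
  pNega_ne_mul_of_not_mem K P' (d := a) (by omega) (by omega) (hg a ha) _ (g3'_pow_not_mem_span_X0_pow a ha) N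

/-- And the modules themselves are not inside the exceptional ideal `(x)` at all (so not inside `(x^a)·N` for any
`a ≥ 1`, `N`): `¬ ℘nega_sw(E′,−a) ⊆ (x)`. [folklore] -/
theorem W1'_sandwichPNega_not_le_span_X0 (e : ℕ) (P' : ℕ → Ideal (MvPolynomial (Fin 3) (ZMod 2)))
    (hg : ∀ d, 0 < d → Nega.g3' ^ d ∈ P' (d * 2)) {a : ℕ} (ha : 0 < a) :
    ¬ sandwichPNega 2 e P' 2 a ≤ Ideal.span {(X 0 : MvPolynomial (Fin 3) (ZMod 2))} := fun h =>
  g3'_pow_not_mem_span_X0_pow a one_pos (by simpa using h (le_sandwichPNega 2 e P' (d := a) (by omega) (by omega)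
    (hg a ha)))

end W1prime

end Summit.ResolutionOfSingularities.ResolutionOfSingularities.Theorems.Campaign.W12

end
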